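import Summits.ResolutionOfSingularities.ResolutionOfSingularities.Theorems.HilbertSamuelEliminationSigmaMaxModificationsCorridor3SigmaMenuGateTame
import HarnessLib

/-!
# [OURS · L1 W4.2] σ-LAYER — `Corridor3SigmaMenuGateTameSplit`: THE TAME SPLIT (res-L1-w42-plan-1 RULING v3.14-48 (PB)/(PF) T-L7, adopting -47 (MD)/(MF)(4)):
# at a `p ∤ m` point the tame tier has FOUR sub-kinds read from `(m, p, S)` only — TAME-LOW (`1 ≤ S < m ∧ p ∤ S`), TAME-MID (`p ∣ S ∧ S < m`, OPEN row T-M0),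
# TAME-HIGH (`S ≥ m`), TAME-SURFACE ((G10a/b)) — and slot (iii) of the tame gate is BY CASES: TAME-HIGH ↦ `high` (a parameter here; OF RECORD := `GroupGate.canonHigh germ` over res-lit-3's
# `ThreadState.IsPrescribedCentre` on the surface germ, sibling `…SigmaMenuGateTameHigh`); TAME-LOW ↦ the named hypothesis `TameLowPrescription` (lineage point while base points remain or snc fails, else the Q₂-face of
# the `H₂` board); TAME-MID ↦ the OPEN named hypothesis `TameMidPrescription`; TAME-SURFACE ↦ `TameSurfacePrescription` ((G10a) `Bl_Σ` / (G10b) `𝓑`-regularisation);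
# (crux chain w42 `SigmaMaxModifications` stmt-ResolutionOfSingularities-18506 / conjunct `SigmaMaxModificationsCorridor3` stmt-ResolutionOfSingularities-19249)

OURS (cell res-hironaka, slot W4.2; typer res-L1-type-o1 g10); NOT statements of H. Hironaka's manuscript [Hironaka2017] nor of [CossartJannsenSaito2020];
AI-typed, weaker than expert review. Helper VOCABULARY `--supports stmt-ResolutionOfSingularities-19249 --as helper` (counted 0). Sibling of
`…SigmaMenuGateTame` (p552890 `GroupGate.tame` / `tameCanonical`, v2 p553779 `CentreGate.tamePrescribed tamePts canon`): the `canon` slot there is filled by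
`GroupGate.tameByKind tk low mid high surface` here. Imports `…SigmaMenuGateTame` (FILE 6's `GroupGate`/`CentreGate.ofCorners`/`ofRecordShapeKE` + v2's
`CentreGate.inf`/`tamePrescribed`), through it res-lit-3's `Literature…NuEliminationBoundaryNEReachable` (`IsBPermissible`); the fuels are the consumer's (002 (γ), RULING -48 (PD)(vi)). `CornerKind` (FILE 6) stays the three-way exact/tame/wild type;
the tame SUB-kind is a second reading `TameKindReading` (067/068-successor's `CornerKindReading.{tameLow,tameMid,tameHigh,tameSurface}` in the ruling's words).

## Contents (namespace `…Theorems.SigmaMaxModificationsCorridor3.Sigma`)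

* `TameKind` {low, mid, high, surface} + `TameKindReading` (read from `(m, p, S)` only — tri-2 (KR-2)/(SP-iii)), `TameKind.gate`.
* **`GroupGate.tameByKind tk low mid high surface`** (slot (iii) by the four cases), unfoldings `tameByKind_of_low/_of_mid/_of_high/_of_surface`,
  `tameByKind_isBPermissible` (if all four branches carry `IsBPermissible` on `W`, so does the case split — then `…MenuGateTame` §4's
  `isBPermissibleOnE_of_tamePrescribed` applies). The HIGH branch OF RECORD, `GroupGate.canonHigh germ` over res-lit-3's `ThreadState.IsPrescribedCentre` on the
  surface germ, lives in the sibling `…SigmaMenuGateTameHigh` (it needs `Literature…NuEliminationThreadNE`); LOW/MID/SURFACE are named hypotheses.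
* **`CentreGate.ofRecordSplit corners face kind γe tamePts tk low mid high surface`** — THE CENTRE GATE OF RECORD, -48 form, ONE term for 002 (γ):
  `(ofCorners corners (ofRecordShapeKE face kind γe ⊤)).inf (tamePrescribed tamePts (tameByKind tk low mid high surface))` — at live EXACT corners on the centre:
  member-face test ∧ `γe`; at live WILD corners: member-face test; at EVERY tame point on the centre: the four-way prescription (the group gate's own tame slot is
  `⊤`, B3: slot (iii) lives in the second conjunct); unfoldings `ofRecordSplit_exact/_wild/_tameLow/_tameMid/_tameHigh/_tameSurface/_of_forall_not_mem`.
* §2 (v2 = PART C; RULING v3.14-49 (RC)) `PointReading`, `GroupGate.splitBy`, **`GroupGate.midSplit snc exactS midWild`** (MID-α ↦ extra-ray exact-type gate,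
  MID-β ↦ the open `TameMidPrescription`) + `_of_snc/_of_not_snc/_isBPermissible`, `CentreGate.ofRecordSplit_tameMidSnc/_tameMidWild`.
VACUITY: `tameByKind` is a genuine four-way case split; `ofRecordSplit` passes exactly the centres FILE 6/B3 describe.
-/

noncomputable section

set_option linter.dupNamespace false -- mandated namespace of this single-conjunct summit

open CategoryTheory AlgebraicGeometry TopologicalSpace
open Summit.ResolutionOfSingularities.ResolutionOfSingularities.Theorems.CampaignW42
open Literature.AlgebraicGeometry.Resolution Literature.RingTheory.HilbertSamuel

namespace Summit.ResolutionOfSingularities.ResolutionOfSingularities.Theorems.SigmaMaxModificationsCorridor3.Sigma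

universe u

section Split

/-- [OURS · L1 W4.2] **THE TAME SUB-KINDS** (RULING v3.14-48 (PB), at a `p ∤ m` point, `S := ord_x N`): LOW `1 ≤ S < m ∧ p ∤ S` (classical descent on
`J = I^S + N^m`), MID `p ∣ S ∧ S < m` (OPEN row T-M0, «level-2 wild»), HIGH `S ≥ m` (the G-thread record), SURFACE (the (G10) sub-kind: a constant-valued
2-dimensional component `Σ_X = V(x, N₁)` through the point). Semantics-free here; the reading is the 067/068-successor's. [folklore] -/
inductive TameKind : Type
  /-- TAME-LOW: `1 ≤ S < m`, `p ∤ S` -/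
  | low
  /-- TAME-MID: `p ∣ S`, `S < m` (open row T-M0) -/
  | mid
  /-- TAME-HIGH: `S ≥ m` -/
  | high
  /-- TAME-SURFACE: the (G10) surface sub-kind -/
  | surface
  deriving DecidableEq

/-- [OURS · L1 W4.2] **A TAME SUB-KIND READING** (instance: from `(m, p, S)` only — tri-2 (KR-2)/(SP-iii); the ruling's
`CornerKindReading.{tameLow,tameMid,tameHigh,tameSurface}`). NOT a statement of the manuscript. [folklore] -/
abbrev TameKindReading : Type (u + 1) :=
  ∀ (W : Scheme.{u}), IsLocallyNoetherian W → ℕ → (ℕ → ℕ) → Labelling W → Option (Pending W) → Boundary W → W → TameKind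

/-- [OURS · L1 W4.2] The proposition a tame sub-kind assigns. [folklore] -/
def TameKind.gate (pl pm ph ps : Prop) : TameKind → Prop
  | .low => pl
  | .mid => pm
  | .high => ph
  | .surface => ps

/-- [OURS · L1 W4.2] **SLOT (iii) BY THE FOUR TAME SUB-KINDS** (RULING v3.14-48 (PF) T-L7 «`tameGate` by cases»). NOT a statement of the manuscript. [folklore] -/
def GroupGate.tameByKind (tk : TameKindReading.{u}) (low mid high surface : GroupGate.{u}) : GroupGate.{u} :=
  fun W hW N ν L P E g C =>
    (tk W hW N ν L P E g).gate (low W hW N ν L P E g C) (mid W hW N ν L P E g C) (high W hW N ν L P E g C) (surface W hW N ν L P E g C)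

variable {tk : TameKindReading.{u}} {low mid high surface : GroupGate.{u}} {N : ℕ} {ν : ℕ → ℕ} {W : Scheme.{u}}
  {hW : IsLocallyNoetherian W} {L : Labelling W} {P : Option (Pending W)} {E : Boundary W} {g : W} {C : W.IdealSheafData}

/-- At a TAME-LOW point the gate is the low branch. [folklore] -/
theorem GroupGate.tameByKind_of_low (h : tk W hW N ν L P E g = .low) :
    GroupGate.tameByKind tk low mid high surface W hW N ν L P E g C ↔ low W hW N ν L P E g C := by
  simp [GroupGate.tameByKind, TameKind.gate, h]

/-- At a TAME-MID point the gate is the mid branch. [folklore] -/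
theorem GroupGate.tameByKind_of_mid (h : tk W hW N ν L P E g = .mid) :
    GroupGate.tameByKind tk low mid high surface W hW N ν L P E g C ↔ mid W hW N ν L P E g C := by
  simp [GroupGate.tameByKind, TameKind.gate, h]

/-- At a TAME-HIGH point the gate is the high branch. [folklore] -/
theorem GroupGate.tameByKind_of_high (h : tk W hW N ν L P E g = .high) :
    GroupGate.tameByKind tk low mid high surface W hW N ν L P E g C ↔ high W hW N ν L P E g C := by
  simp [GroupGate.tameByKind, TameKind.gate, h]

/-- At a TAME-SURFACE point the gate is the surface branch. [folklore] -/
theorem GroupGate.tameByKind_of_surface (h : tk W hW N ν L P E g = .surface) :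
    GroupGate.tameByKind tk low mid high surface W hW N ν L P E g C ↔ surface W hW N ν L P E g C := by
  simp [GroupGate.tameByKind, TameKind.gate, h]

/-- The case split carries `𝓑`-permissibility on `W` whenever all four branches do (then `…MenuGateTame` §4's `tamePrescribed_isBPermissible` /
`isBPermissibleOnE_of_tamePrescribed` apply to `canon := tameByKind tk low mid high surface`). [cite: CossartJannsenSaito2020, Def. 5.4] -/
theorem GroupGate.tameByKind_isBPermissible (hl : ∀ W hW N ν L P E g C, low W hW N ν L P E g C → IsBPermissible C E)
    (hm : ∀ W hW N ν L P E g C, mid W hW N ν L P E g C → IsBPermissible C E) (hh : ∀ W hW N ν L P E g C, high W hW N ν L P E g C → IsBPermissible C E)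
    (hs : ∀ W hW N ν L P E g C, surface W hW N ν L P E g C → IsBPermissible C E)
    (h : GroupGate.tameByKind tk low mid high surface W hW N ν L P E g C) : IsBPermissible C E := by
  revert h
  cases hk : tk W hW N ν L P E g with
  | low => rw [GroupGate.tameByKind_of_low hk]; exact hl W hW N ν L P E g C
  | mid => rw [GroupGate.tameByKind_of_mid hk]; exact hm W hW N ν L P E g C
  | high => rw [GroupGate.tameByKind_of_high hk]; exact hh W hW N ν L P E g C
  | surface => rw [GroupGate.tameByKind_of_surface hk]; exact hs W hW N ν L P E g C

/-- [OURS · L1 W4.2] **THE CENTRE GATE OF RECORD, RULING v3.14-48 form** (FILE 6 (JI)/(JJ) + (KE′) + ADDENDUM B3 + (PF) T-L7), the single term the (d-β)-SIM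
instance (002 (γ)) plugs into `SiteProposal.gated` / `StrategyE.surfacePhaseGated`: a centre passes iff (1) every live group corner on it lets it pass under the
(KE′) shape with the tame slot trivial (exact: member-face test ∧ `γe`; wild: member-face test; tame: nothing here) AND (2) at every closed TAME point on it the
four-way prescription holds (`tameByKind`). Readings (all parameters, by name): `corners`/`kind` (067/068-successor (G2a): kinds from `(m, p, S)`), `face` (member-face test,
-39 (JN)), `γe` (060's `QAllowed` via face identification / (d-δ) Q₂), `tamePts`/`tk` (tame points and their sub-kinds), the four prescriptions (HIGH of record := `GroupGate.canonHigh germ`,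
sibling `…SigmaMenuGateTameHigh`; LOW/MID/SURFACE named hypotheses of the 067/068-successor's readings). NOT a statement of the manuscript. [folklore] -/
def CentreGate.ofRecordSplit (corners : CornerReading.{u}) (face : GroupGate.{u}) (kind : CornerKindReading.{u}) (γe : GroupGate.{u})
    (tamePts : CornerReading.{u}) (tk : TameKindReading.{u})
    (TameLowPrescription TameMidPrescription TameHighPrescription TameSurfacePrescription : GroupGate.{u}) : CentreGate.{u} :=
  CentreGate.inf (CentreGate.ofCorners corners (GroupGate.ofRecordShapeKE face kind γe fun _ _ _ _ _ _ _ _ _ => True))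
    (CentreGate.tamePrescribed tamePts
      (GroupGate.tameByKind tk TameLowPrescription TameMidPrescription TameHighPrescription TameSurfacePrescription))

variable {corners tamePts : CornerReading.{u}} {face γe : GroupGate.{u}} {kind : CornerKindReading.{u}}

/-- At a live EXACT corner on the centre: the member-face test and `γe`. [folklore] -/
theorem CentreGate.ofRecordSplit_exact (h : CentreGate.ofRecordSplit corners face kind γe tamePts tk low mid high surface W hW N ν L P E C)
    (hg : g ∈ corners W hW N ν L P E) (hgC : g ∈ (C.support : Set W)) (hk : kind W hW N ν L P E g = .exact) :
    face W hW N ν L P E g C ∧ γe W hW N ν L P E g C :=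
  (GroupGate.ofRecordShapeKE_of_exact hk).mp (h.1 g hg hgC)

/-- At a live WILD corner on the centre: the member-face test. [folklore] -/
theorem CentreGate.ofRecordSplit_wild (h : CentreGate.ofRecordSplit corners face kind γe tamePts tk low mid high surface W hW N ν L P E C)
    (hg : g ∈ corners W hW N ν L P E) (hgC : g ∈ (C.support : Set W)) (hk : kind W hW N ν L P E g = .wild) : face W hW N ν L P E g C :=
  (GroupGate.ofRecordShapeKE_of_wild hk).mp (h.1 g hg hgC)

/-- At a TAME-LOW point on the centre: the low prescription. [folklore] -/
theorem CentreGate.ofRecordSplit_tameLow (h : CentreGate.ofRecordSplit corners face kind γe tamePts tk low mid high surface W hW N ν L P E C)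
    (hx : g ∈ tamePts W hW N ν L P E) (hxC : g ∈ (C.support : Set W)) (hk : tk W hW N ν L P E g = .low) : low W hW N ν L P E g C :=
  (GroupGate.tameByKind_of_low hk).mp (h.2 g hx hxC)

/-- At a TAME-MID point on the centre: the mid prescription (open row T-M0). [folklore] -/
theorem CentreGate.ofRecordSplit_tameMid (h : CentreGate.ofRecordSplit corners face kind γe tamePts tk low mid high surface W hW N ν L P E C)
    (hx : g ∈ tamePts W hW N ν L P E) (hxC : g ∈ (C.support : Set W)) (hk : tk W hW N ν L P E g = .mid) : mid W hW N ν L P E g C :=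
  (GroupGate.tameByKind_of_mid hk).mp (h.2 g hx hxC)

/-- At a TAME-HIGH point on the centre: the high prescription (OF RECORD: `GroupGate.canonHigh germ`, sibling file). [folklore] -/
theorem CentreGate.ofRecordSplit_tameHigh (h : CentreGate.ofRecordSplit corners face kind γe tamePts tk low mid high surface W hW N ν L P E C)
    (hx : g ∈ tamePts W hW N ν L P E) (hxC : g ∈ (C.support : Set W)) (hk : tk W hW N ν L P E g = .high) : high W hW N ν L P E g C :=
  (GroupGate.tameByKind_of_high hk).mp (h.2 g hx hxC)

/-- At a TAME-SURFACE point on the centre: the surface prescription ((G10a/b)). [folklore] -/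
theorem CentreGate.ofRecordSplit_tameSurface (h : CentreGate.ofRecordSplit corners face kind γe tamePts tk low mid high surface W hW N ν L P E C)
    (hx : g ∈ tamePts W hW N ν L P E) (hxC : g ∈ (C.support : Set W)) (hk : tk W hW N ν L P E g = .surface) : surface W hW N ν L P E g C :=
  (GroupGate.tameByKind_of_surface hk).mp (h.2 g hx hxC)

/-- A centre missing every live corner and every tame point passes (PHASE S centres ⊆ Sing D, non-corner points, …). [folklore] -/
theorem CentreGate.ofRecordSplit_of_forall_not_mem (hc : ∀ g ∈ corners W hW N ν L P E, g ∉ (C.support : Set W))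
    (ht : ∀ g ∈ tamePts W hW N ν L P E, g ∉ (C.support : Set W)) :
    CentreGate.ofRecordSplit corners face kind γe tamePts tk low mid high surface W hW N ν L P E C :=
  ⟨CentreGate.ofCorners_of_forall_not_mem hc, CentreGate.ofCorners_of_forall_not_mem ht⟩

end Split


/-! ## §2. (appended 2026-08-27, same seat, v2 = PART C) RULING v3.14-49 (RA)/(RC) + DESK WORD 18:38:03Z: TAME-MID SPLITS BY THE POINT TEST `snc` —
MID-α («`Sing_{S₀}(N)` 2-dimensional at the point and its surface germ `Σ` n.c. with `𝓑(x)`», (RB)) ROUTES TO AN EXACT-TYPE GROUP GATE `exactS` (instance: procedure Q on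
the `TState` whose rays are `𝓑(x) ∪ {r_Σ}`, `expo r_Σ := S₀` — `CentreGate.ofCorners`/`GroupGate` are typed over POINTS and an abstract gate, so the extra ray lives in
the INSTANCE, no new constructor here), MID-β to the OPEN named hypothesis `TameMidPrescription` (row T-M0 proper). Plug `GroupGate.midSplit snc exactS midWild` into
the `mid` argument of `tameByKind` / `CentreGate.ofRecordSplit`. -/

/-- [OURS · L1 W4.2] A POINT READING: a predicate on points of a state (instance: `snc` of RULING v3.14-49 (RB), read from `((α_B)_B, S₀, m, [Σ ∈ 𝓑-snc surfaces
through x])`). NOT a statement of the manuscript. [folklore] -/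
abbrev PointReading : Type (u + 1) :=
  ∀ (W : Scheme.{u}), IsLocallyNoetherian W → ℕ → (ℕ → ℕ) → Labelling W → Option (Pending W) → Boundary W → W → Prop

/-- [OURS · L1 W4.2] **A GROUP GATE BY CASES ON A POINT TEST** (generic). NOT a statement of the manuscript. [folklore] -/
def GroupGate.splitBy (test : PointReading.{u}) (yes no : GroupGate.{u}) : GroupGate.{u} :=
  fun W hW N ν L P E g C => (test W hW N ν L P E g → yes W hW N ν L P E g C) ∧ (¬ test W hW N ν L P E g → no W hW N ν L P E g C)

/-- [OURS · L1 W4.2] **THE TAME-MID SPLIT** (RULING v3.14-49 (RC)): MID-α (`snc` holds) ↦ the extra-ray EXACT-type gate `exactS`; MID-β ↦ `midWild` (the OPEN named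
hypothesis `TameMidPrescription`). `= splitBy snc exactS midWild`. NOT a statement of the manuscript. [folklore] -/
abbrev GroupGate.midSplit (snc : PointReading.{u}) (exactS midWild : GroupGate.{u}) : GroupGate.{u} :=
  GroupGate.splitBy snc exactS midWild

section MidSplit

variable {test snc : PointReading.{u}} {yes no exactS midWild : GroupGate.{u}} {N : ℕ} {ν : ℕ → ℕ} {W : Scheme.{u}} {hW : IsLocallyNoetherian W}
  {L : Labelling W} {P : Option (Pending W)} {E : Boundary W} {g : W} {C : W.IdealSheafData}

/-- Where the test holds the gate is the `yes` branch. [folklore] -/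
theorem GroupGate.splitBy_of_pos (h : test W hW N ν L P E g) : GroupGate.splitBy test yes no W hW N ν L P E g C ↔ yes W hW N ν L P E g C :=
  ⟨fun hs => hs.1 h, fun hy => ⟨fun _ => hy, fun hn => absurd h hn⟩⟩

/-- Where the test fails the gate is the `no` branch. [folklore] -/
theorem GroupGate.splitBy_of_neg (h : ¬ test W hW N ν L P E g) : GroupGate.splitBy test yes no W hW N ν L P E g C ↔ no W hW N ν L P E g C :=
  ⟨fun hs => hs.2 h, fun hn => ⟨fun hy => absurd hy h, fun _ => hn⟩⟩

/-- The split carries `𝓑`-permissibility whenever both branches do. [cite: CossartJannsenSaito2020, Def. 5.4] -/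
theorem GroupGate.splitBy_isBPermissible (hy : ∀ W hW N ν L P E g C, yes W hW N ν L P E g C → IsBPermissible C E)
    (hn : ∀ W hW N ν L P E g C, no W hW N ν L P E g C → IsBPermissible C E) (h : GroupGate.splitBy test yes no W hW N ν L P E g C) :
    IsBPermissible C E := by
  by_cases ht : test W hW N ν L P E g
  · exact hy W hW N ν L P E g C (h.1 ht)
  · exact hn W hW N ν L P E g C (h.2 ht)

/-- MID-α: at an `snc` point the tame-mid gate is the extra-ray exact-type gate. [folklore] -/
theorem GroupGate.midSplit_of_snc (h : snc W hW N ν L P E g) : GroupGate.midSplit snc exactS midWild W hW N ν L P E g C ↔ exactS W hW N ν L P E g C :=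
  GroupGate.splitBy_of_pos h

/-- MID-β: at a non-`snc` point the tame-mid gate is the open named hypothesis. [folklore] -/
theorem GroupGate.midSplit_of_not_snc (h : ¬ snc W hW N ν L P E g) :
    GroupGate.midSplit snc exactS midWild W hW N ν L P E g C ↔ midWild W hW N ν L P E g C :=
  GroupGate.splitBy_of_neg h

/-- The tame-mid split carries `𝓑`-permissibility whenever both branches do. [cite: CossartJannsenSaito2020, Def. 5.4] -/
theorem GroupGate.midSplit_isBPermissible (he : ∀ W hW N ν L P E g C, exactS W hW N ν L P E g C → IsBPermissible C E)
    (hm : ∀ W hW N ν L P E g C, midWild W hW N ν L P E g C → IsBPermissible C E) (h : GroupGate.midSplit snc exactS midWild W hW N ν L P E g C) :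
    IsBPermissible C E :=
  GroupGate.splitBy_isBPermissible he hm h

variable {corners tamePts : CornerReading.{u}} {face γe low high surface : GroupGate.{u}} {kind : CornerKindReading.{u}} {tk : TameKindReading.{u}}

/-- **The centre gate of record with the tame-mid split plugged: at a MID-α point on a passing centre, the extra-ray exact-type gate.** [folklore] -/
theorem CentreGate.ofRecordSplit_tameMidSnc
    (h : CentreGate.ofRecordSplit corners face kind γe tamePts tk low (GroupGate.midSplit snc exactS midWild) high surface W hW N ν L P E C)
    (hx : g ∈ tamePts W hW N ν L P E) (hxC : g ∈ (C.support : Set W)) (hk : tk W hW N ν L P E g = .mid) (hs : snc W hW N ν L P E g) :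
    exactS W hW N ν L P E g C :=
  (GroupGate.midSplit_of_snc hs).mp (CentreGate.ofRecordSplit_tameMid h hx hxC hk)

/-- … and at a MID-β point, the open named hypothesis. [folklore] -/
theorem CentreGate.ofRecordSplit_tameMidWild
    (h : CentreGate.ofRecordSplit corners face kind γe tamePts tk low (GroupGate.midSplit snc exactS midWild) high surface W hW N ν L P E C)
    (hx : g ∈ tamePts W hW N ν L P E) (hxC : g ∈ (C.support : Set W)) (hk : tk W hW N ν L P E g = .mid) (hs : ¬ snc W hW N ν L P E g) :
    midWild W hW N ν L P E g C :=
  (GroupGate.midSplit_of_not_snc hs).mp (CentreGate.ofRecordSplit_tameMid h hx hxC hk)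

end MidSplit

end Summit.ResolutionOfSingularities.ResolutionOfSingularities.Theorems.SigmaMaxModificationsCorridor3.Sigma

end
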